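import Summits.SmoothPoincare4.SmoothPoincare4.Theses.CylinderEntropy
import Literature.Geometry.Riemannian.SphericalCylinderEntropy
import Literature.Geometry.Riemannian.RoundSphere
import Literature.Geometry.Riemannian.LevelSetMeanCurvature
import Literature.Geometry.Lorentzian.LeviCivitaProofs
import Literature.Topology.FourManifolds.HomotopyS4CompactProofs
import HarnessLib
import HarnessLib.Audit

/-!
# Line `killing-flux` — crux `CylinderEntropy.CylinderRungTwo` (stmt-SmoothPoincare4-7631, rank 2)

Skeleton (crux-plan, round 1; planner-cruxplan-stmt-SmoothPoincare4-7631-killing-flux-0, 2026-08-16).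
LEAD RESHAPE r1 (prover-line-stmt-SmoothPoincare4-7631-0, 2026-08-16): the registered signatures of
`stub_fluxIdentity` and `stub_graphicalIsSphere` are SPELLED OUT in tree vocabulary (the typed
`JoinedIn` clause, `truncL`, Mathlib/Literature names only), so that a landed `Theorems/` file — which
cannot import this workfile — proves them verbatim; `FluxIdentity` / `GraphicalIsSphere` keep the same
text as readable `def`s and the composition is unchanged (definitional unfolding).
Idea card `Cruxes/CylinderRungTwo/Ideas/killing-flux.md` (ideator 1); triage r1-1/2/3: pass ×3 with the
common findings (i) the ideator's typed first lemma `Sketch.FluxIdentity` is FALSE as typed — witness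
`CylinderSlice.twoSlices` + `f = z₅(z₅-1)` (`Triage.fluxIdentity_false`, three sorry-free proofs) —
repair: `[ConnectedSpace M]` (adopted below, and the defining function is replaced by the unit normal
field itself, so no sign convention can leak); (ii) merge with `ground-state-relaxation` on the
immortal half (adopted: `stub_relaxation` is the RELAXATION statement, proved either by the card's
first-variation horizontality + conserved flux or by the two-sided maximum principle); (iii) the
load-bearing open step shared by every line is the finite-time port of Chodosh–Mantoulidis–Schulze /
Daniels-Holgate to `N` (isolated below as ONE named stub, `stub_finiteTimeHalf`).

THE CRUX (route `CylinderEntropy`, R = rung 2): a smooth embedding `ι` of a homotopy 4-sphere `M` into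
`N = S⁴ × ℝ = {z ∈ ℝ⁶ | ∑_{i<5} zᵢ² = 1}` separating the two ends, with typed cylinder entropy
`λ_cyl(range ι) < 4/e`, has `M ≃ₘ S⁴`.

THE LINE (the vertical angle `u = ⟪ν, e₅⟫ = ν₅` settles the immortal component). Mean curvature
flow of cross-sections IN `N` is typed extrinsically (`IsCylinderMCF`: embeddings `F t : M → ℝ⁶` with
image in `N`, unit normal `ν t` normal to `Σ_t = F t(M)` and tangent to `N`, and `∂F/∂t = -H ν` with
`H` the tree's `meanCurvature` of `(F t, ν t)` in `ℝ⁶`, which for `ν ⊥ n_N` IS the mean curvature of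
`Σ_t ⊂ N`). Then `CylinderRungTwo` is the composition of five registered stubs:

* `stub_finiteTimeHalf` (THE FINITE-TIME HALF; shared with every line; research-level): from a thin
  homotopy-sphere cross-section, mean curvature flow with surgery in `N` (generic perturbation below
  `4/e` ⇒ only `S³ × ℝ` necks and round `S⁴` points — CMS Cor. 1.5(b)/1.22(b) ported to `N`; CHHW
  canonical neighbourhoods hold in arbitrary ambients; every neck on a homotopy-sphere component
  separates it, so all split-off components are homotopy spheres dying at round points and the ROOT —
  the end-separating component, never extinct by the area floor — is diffeomorphic to `M`) produces,
  after its finitely many surgery times, an IMMORTAL SMOOTH flow `(F t)_{t ≥ T}` of cross-section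
  embeddings of `M` itself, separating, with `λ_cyl < 4/e` (Hamilton monotonicity) and confined to the
  slab of `ι` (avoidance with slices).
* `stub_fluxIdentity` (F — the line's lever, repaired): for a CONNECTED compact cross-section with a
  continuous unit normal `ν` tangent to `N`, `|∫_M ν₅ dμ| = vol(S⁴)`: the flux of the parallel Killing
  field `∂_s = e₅` through `M` (`Ω = ι_{e₅} dvol_N` is closed; divergence theorem on the region of `N`
  between `M` and a low slice; connectedness makes `N ∖ M` two-ended so the sign is constant).
* `stub_relaxation` (the immortal half; killing-flux T3 ≈ ground-state RELAXATION): an immortal smooth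
  flow of compact connected separating cross-sections with `λ_cyl < 2` has `λ_cyl(F s) → 1`: area is a
  Lyapunov function with floor `vol S⁴` (tree `hausdorffMeasure_sphere_le_of_separatesEnds`), so
  `∫∫ H² < ∞`; slab-tightness by avoidance; subsequential limits are stationary integral varifolds of
  mass in `[vol, 2 vol)`, horizontal by the first variation along `φ(s) ∂_s` (or squeezed between their
  top and bottom slices by the strong maximum principle), hence ONE slice with multiplicity ONE; backward
  Hamilton monotonicity moves every scale to `τ ≥ 1`, where `F̂` is continuous, and the slice has
  `λ_cyl = 1` (support item `SliceCalibration`, stmt-7634) ⇒ `λ_cyl(F s) < 1 + ε` for all large `s`.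
* `stub_epsilonGraphical` (ε-REGULARITY TO A GRAPH, typed `FluxIdentity → EpsilonGraphical`): there is
  a universal `ε > 0` such that one unit of smooth flow with `λ_cyl < 1 + ε` ends GRAPHICAL: White's
  local regularity (scales `< r₀ ≪ inj N = π`, where the typed kernel IS the Gaussian density ratio up
  to `1 + o(1)`) bounds `|A| ≤ C` on `M_t`; the FLUX IDENTITY turns the area excess
  `μH⁴(M_t) - μH⁴(S⁴) ≤ ε μH⁴(S⁴)` (tree `measure_ratio_le_cylEntropy`) into the tilt budget
  `∫_{M_t} (1 - u) = area - vol ≤ ε vol` (orient `ν` so that the flux is `+vol`), and `|∇u| ≤ |A| ≤ C`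
  upgrades it to `u > 1/2` pointwise for `ε < ε(C)`; so the shadow `truncL ∘ F t : M → S⁴` is an
  immersion, and it has ONE sheet because `∫ u = (#sheets) · vol(S⁴)` (area formula, `u` = Jacobian of
  the shadow) equals the flux `vol(S⁴)`.
* `stub_graphicalIsSphere` (differential topology): a compact connected `M` with a cross-section
  embedding whose shadow in `S⁴` is an injective immersion is diffeomorphic to `S⁴` (inverse function
  theorem: the shadow is open and closed, hence a bijective local diffeomorphism onto the connected
  `S⁴`).

The composition `cylinderRungTwo_of_parts` is pure logic plus `4/e ≤ 2` and the instances
`CompactSpace M`, `ConnectedSpace M` from `M ≃ₕ S⁴` (PROVED tree theorems); `CylinderRungTwo_of :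
CylinderRungTwo` concludes the crux BY NAME from the five registered stubs (`lean check` rc 0, sorries
only inside `stub_*`). NON-VACUITY OF THE INTERFACE (PROVED, standard axioms):
`isCylinderMCF_staticSlice` — the static slice `F t = sliceMap c`, `ν t = e₅` satisfies every clause
of `IsCylinderMCF`; in particular slices are minimal in the typed sense (`meanCurvature_sliceMap`:
`H = 0` from the tree's level-set formula for the linear height `z₅`), so the velocity convention
`∂F/∂t = -H ν` is consistent and the hypotheses of stubs 3–4 are satisfiable (the audit lists these
lemmas as `orphan`: they serve non-vacuity, not the composition).

DISPROOF USED (standing disprover refuter-cdisprove-stmt-SmoothPoincare4-7631-0; the body of its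
`Disproof.lean` is not mounted on this hub — read through its seven evidence notes, as the triagers did):
(i) SANDWICH `cylinderRungTwo_of_spc4` / `exotic_of_not_rung`: R is neither cheaply refutable nor
provable short of SPC4-for-thin-spheres — honoured: the SPC4-hard content sits in exactly one named
stub, `stub_finiteTimeHalf` (its conclusion, an immortal smooth flow of `M`, fails for a thin exotic
cross-section and holds for the slice of `S⁴` via the static flow), while stubs 2–5 are topology-free
analysis/differential topology; (ii) LOAD-BEARING HYPOTHESES (`rungWithout{Homotopy,Separation,Entropy,
Embedding}`, `rungWithoutHomotopyEntropy_false` with witness `S⁴ ⊔ S⁴ = twoSlices`,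
`two_le_cylEntropy_twoSlices`): `M ≃ₕ S⁴` is consumed by `stub_finiteTimeHalf` (simple connectivity:
necks separate) and, as compactness + connectedness, by stubs 2–5 (`[CompactSpace M] [ConnectedSpace M]`
— the flux identity is FALSE without connectedness, triage `fluxIdentity_false`); the entropy
hypothesis is consumed at `4/e` by stub 1 (genericity), at `2` by stub 3 (one sheet in the limit) and at
`1 + ε` by stub 4; separation by stubs 2–4 (degree one / area floor); the embedding by all;
(iii) PROVED FACTS reused, not re-stubbed: `measure_le_cylEntropy` = tree `measure_ratio_le_cylEntropy`,
`areaFloor` = tree `hausdorffMeasure_sphere_le_of_separatesEnds`, `one_le_cylEntropy_slice`. No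
`_false_without_` theorem is contradicted (no stub drops `M ≃ₕ S⁴`-compactness/connectedness where it
matters); no `Negative/` lemma has landed for this crux (`ledger crux ls`, 2026-08-16T00:3xZ); negatives
index for SmoothPoincare4: empty.
-/

noncomputable section

open MeasureTheory Set
open scoped Manifold ContDiff ENNReal Topology BigOperators ContinuousMap RealInnerProductSpace Gradient

namespace Summit.SmoothPoincare4.SmoothPoincare4.Cruxes.CylinderRungTwo.KillingFlux

open Literature.Geometry.Riemannian
open Literature.Geometry.Lorentzian Literature.Geometry.Lorentzian.PseudoRiemannianMetric
open Literature.Geometry.Riemannian.SphericalCylinderEntropy (cylKernel cylDensity cylEntropy truncL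
  measure_ratio_le_cylEntropy hausdorffMeasure_sphere_four_pos hausdorffMeasure_sphere_four_lt_top)
open Summit.SmoothPoincare4.SmoothPoincare4.Theses.CylinderEntropy (CylinderRungTwo SliceCalibration)

set_option linter.dupNamespace false

local notation "E4" => EuclideanSpace ℝ (Fin 4)
local notation "E5" => EuclideanSpace ℝ (Fin 5)
local notation "E6" => EuclideanSpace ℝ (Fin 6)

/-- The Euclidean metric of `ℝ⁶` carries its Levi-Civita connection (the tree's general existence
theorem `PseudoRiemannianMetric.hasLeviCivita`), as an instance for the mean curvature below
(the tree's `ShrinkingSphereMCF` instance is stated over `Fin (n + 1)` and is not imported here).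
[folklore] -/
instance euclideanMetric_hasLeviCivita_E6 : (euclideanMetric E6).HasLeviCivita :=
  (euclideanMetric E6).hasLeviCivita

/-! ## The objects -/

/-- The round cylinder `N = S⁴ × ℝ ⊂ ℝ⁶`, exactly as typed in the route items. [folklore] -/
def cylN : Set E6 := {z | ∑ i : Fin 5, z (Fin.castSucc i) ^ 2 = 1}

/-- The typed end-separation predicate of the route items: no path in `N ∖ A` from height `≤ -R` to
height `≥ R`. [folklore] -/
def SeparatesEnds (A : Set E6) : Prop :=
  ∃ R : ℝ, ∀ a b : E6, ∑ i : Fin 5, a (Fin.castSucc i) ^ 2 = 1 → ∑ i : Fin 5, b (Fin.castSucc i) ^ 2 = 1 →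
    a 5 ≤ -R → R ≤ b 5 → ¬ JoinedIn (cylN \ A) a b

/-- `ι : M → N` is GRAPHICAL over the slices: its shadow `truncL ∘ ι : M → ℝ⁵` (drop the height
coordinate; tree `truncL`, 1-Lipschitz) is an injective immersion. For a connected compact
cross-section with unit normal `ν` in `N` this says: the vertical angle `u = ⟪ν, e₅⟫` never vanishes
(immersion) and the shadow has one sheet (injective). [folklore] -/
def IsGraphical (M : Type) [TopologicalSpace M] [ChartedSpace E4 M] (ι : M → E6) : Prop :=
  Function.Injective ((truncL : E6 → E5) ∘ ι) ∧
    ∀ x : M, Function.Injective (mfderiv (𝓡 4) (𝓡 5) ((truncL : E6 → E5) ∘ ι) x)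

/-- **A smooth mean curvature flow of embedded cross-sections of `N = S⁴ × ℝ` on `[T, ∞)`**, written
extrinsically in `ℝ⁶` with the tree's hypersurface vocabulary (`Lorentzian/Hypersurface.lean`; the
tree's `IsClassicalMCF` is dimension-locked to hypersurfaces of the ambient manifold, and a
cross-section has codimension 2 in `ℝ⁶`). Data: `F t : M → ℝ⁶` the embeddings and `ν t : M → ℝ⁶` the
unit normal of `Σ_t = F t (M)` INSIDE `N`: normal to `Σ_t` (`IsUnitNormal`) and tangent to `N`
(`normal_tangent`: orthogonal to the radial normal `n = (z', 0)` of `N`). Since `ν ⊥ n`, the tree's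
scalar `meanCurvature (F t) _ _ (ν t) x = tr_{F_t^*δ} ⟨D ν, dF⟩` computed in `ℝ⁶` IS the mean
curvature `H_N` of `Σ_t ⊂ N` with respect to `ν` (the `ℝ⁶`- and `N`-second fundamental forms of `Σ_t`
differ by a multiple of `n ⊥ ν`), and `∂F/∂t = -H_N ν` is mean curvature flow in the Riemannian
manifold `N` (tree sign convention: round spheres with the outward normal have `H > 0` and shrink; the
vector `-H ν` does not depend on the sign of `ν`); this is the flow of Hamilton's monotonicity formula
(Comm. Anal. Geom. 1 (1993) 127–137, doi:10.4310/cag.1993.v1.n1.a7) in the ambient `N`. Non-vacuous: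
the static slice `F t = sliceMap c`, `ν t = e₅` (`H = 0`, `isCylinderMCF_staticSlice` below). [folklore] -/
structure IsCylinderMCF (M : Type) [TopologicalSpace M] [ChartedSpace E4 M] [IsManifold (𝓡 4) ∞ M]
    (F : ℝ → M → E6) (ν : ℝ → M → E6) (T : ℝ) : Prop where
  /-- The family is jointly smooth on `U × M` for some open `U ⊇ [T, ∞)`. -/
  contMDiffOn : ∃ U : Set ℝ, IsOpen U ∧ Set.Ici T ⊆ U ∧
    ContMDiffOn (𝓘(ℝ, ℝ).prod (𝓡 4)) (𝓡 6) ∞ (fun p : ℝ × M => F p.1 p.2) (U ×ˢ Set.univ)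
  /-- Each `F t`, `t ≥ T`, is a smooth embedding (the cross-sections are embedded). -/
  isSmoothEmbedding : ∀ t, T ≤ t → Manifold.IsSmoothEmbedding (𝓡 4) (𝓡 6) ∞ (F t)
  /-- Each `F t`, `t ≥ T`, lands in the cylinder `N`. -/
  mem_cyl : ∀ t, T ≤ t → ∀ x, ∑ i : Fin 5, F t x (Fin.castSucc i) ^ 2 = 1
  /-- Each `F t`, `t ≥ T`, is a (spacelike =) immersion for the Euclidean metric, so that the tree's
  induced metric and mean curvature apply (implied by `isSmoothEmbedding`; kept as data of the
  interface). -/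
  isSpacelikeImmersion : ∀ t, T ≤ t → (euclideanMetric E6).IsSpacelikeImmersion (𝓡 4) (F t)
  /-- `ν t` is a unit normal along `F t`: `⟪ν, dF v⟫ = 0` for all `v` and `‖ν‖ = 1`. -/
  isUnitNormal : ∀ t, T ≤ t → (euclideanMetric E6).IsUnitNormal (𝓡 4) (F t) (ν t) 1
  /-- `ν t x` is tangent to `N` at `F t x` (orthogonal to the radial normal `(z', 0)` of `N`). -/
  normal_tangent : ∀ t, T ≤ t → ∀ x, ∑ i : Fin 5, ν t x (Fin.castSucc i) * F t x (Fin.castSucc i) = 0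
  /-- Each `ν t` is smooth. -/
  contMDiff_normal : ∀ t, T ≤ t → ContMDiff (𝓡 4) (𝓡 6) ∞ (ν t)
  /-- The flow equation `∂F/∂t = -H_N ν` on `[T, ∞)`. -/
  velocity_eq : ∀ t (ht : T ≤ t) (x : M),
    mfderiv 𝓘(ℝ, ℝ) (𝓡 6) (fun s => F s x) t (1 : ℝ) =
      -((euclideanMetric E6).meanCurvature (F t) contMDiff_pullbackBilin_holds
          (isSpacelikeImmersion t ht) (ν t) x) • ν t x


/-! ## Non-vacuity of the interface: the static slice is a cylinder flow -/

section StaticSlice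

open Literature.Geometry.Manifold.CylinderSlice

set_option hygiene false in
local notation "S4" => Metric.sphere (0 : EuclideanSpace ℝ (Fin 5)) 1

/-- The height `z ↦ z₅ = ⟪e₅, z⟫` as a continuous linear functional on `ℝ⁶`. [folklore] -/
def heightL : E6 →L[ℝ] ℝ := innerSL ℝ (axis : E6)

theorem heightL_apply (z : E6) : heightL z = ⟪axis, z⟫ := rfl

theorem heightL_apply' (z : E6) : heightL z = z 5 := by
  rw [heightL_apply, axis, EuclideanSpace.inner_single_left]
  simp

/-- `∇ z₅ = e₅`. [folklore] -/
theorem gradient_heightL (z : E6) : ∇ (heightL : E6 → ℝ) z = axis := by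
  refine ext_inner_right ℝ fun v => ?_
  rw [inner_gradient_eq_fderiv, ContinuousLinearMap.fderiv, heightL_apply]

/-- The unit gradient of the height is the constant field `e₅`. [folklore] -/
theorem unitGradient_heightL (z : E6) : unitGradient (heightL : E6 → ℝ) z = axis := by
  rw [unitGradient, gradient_heightL]
  simp [axis]

/-- The slice embedding is `C^m` for every `m`. [folklore] -/
theorem contMDiff_sliceMap (c : ℝ) {m : ℕ∞ω} : ContMDiff (𝓡 4) (𝓡 6) m (sliceMap c) := by
  haveI : Fact (Module.finrank ℝ E5 = 4 + 1) := ⟨finrank_euclideanSpace_fin⟩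
  have hA : ContDiff ℝ m (fun y : E5 => padL y + c • axis) := padL.contDiff.add contDiff_const
  have hval : ContMDiff (𝓡 4) 𝓘(ℝ, E5) m (Subtype.val : S4 → E5) := contMDiff_coe_sphere
  rw [sliceMap_eq_comp]
  exact hA.comp_contMDiff hval

/-- The differential of the slice embedding is `padL ∘ dι` (`ι : S⁴ ↪ ℝ⁵`). [folklore] -/
theorem mfderiv_sliceMap (c : ℝ) (x : S4) :
    mfderiv (𝓡 4) (𝓡 6) (sliceMap c) x =
      padL.comp (mfderiv (𝓡 4) 𝓘(ℝ, E5) (Subtype.val : S4 → E5) x) := by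
  haveI : Fact (Module.finrank ℝ E5 = 4 + 1) := ⟨finrank_euclideanSpace_fin⟩
  have hval : ContMDiff (𝓡 4) 𝓘(ℝ, E5) ∞ (Subtype.val : S4 → E5) := contMDiff_coe_sphere
  have h1 : HasMFDerivAt (𝓡 4) 𝓘(ℝ, E5) (Subtype.val : S4 → E5) x
      (mfderiv (𝓡 4) 𝓘(ℝ, E5) (Subtype.val : S4 → E5) x) :=
    ((hval x).mdifferentiableAt (by simp)).hasMFDerivAt
  have h2 : HasFDerivAt (fun y : E5 => padL y + c • axis) padL (x : E5) :=
    padL.hasFDerivAt.add_const _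
  have h3 := h2.hasMFDerivAt.comp x h1
  rw [sliceMap_eq_comp]
  exact h3.mfderiv

/-- Tangent vectors of a slice are horizontal: `⟪e₅, d(sliceMap) w⟫ = 0` (stated with Mathlib's
vector-valued `mvfderiv`, definitionally `mfderiv`). [folklore] -/
theorem heightL_mvfderiv_sliceMap (c : ℝ) (x : S4) (w : TangentSpace (𝓡 4) x) :
    heightL (mvfderiv (𝓡 4) (sliceMap c) x w) = 0 := by
  have h : mvfderiv (𝓡 4) (sliceMap c) x w =
      padL (mvfderiv (𝓡 4) (Subtype.val : S4 → E5) x w) :=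
    DFunLike.congr_fun (mfderiv_sliceMap c x) w
  rw [h, heightL_apply']
  exact padL_apply_last _

/-- The differential of the slice embedding is injective. [folklore] -/
theorem mfderiv_sliceMap_injective (c : ℝ) (x : S4) :
    Function.Injective (mfderiv (𝓡 4) (𝓡 6) (sliceMap c) x) := by
  haveI : Fact (Module.finrank ℝ E5 = 4 + 1) := ⟨finrank_euclideanSpace_fin⟩
  rw [mfderiv_sliceMap]
  exact padL_injective.comp (mfderiv_coe_sphere_injective x)

/-- The slice embedding is a (spacelike =) immersion for the Euclidean metric. [folklore] -/
theorem isSpacelikeImmersion_sliceMap (c : ℝ) :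
    (euclideanMetric E6).IsSpacelikeImmersion (𝓡 4) (sliceMap c) := by
  refine ⟨contMDiff_sliceMap c, fun y v hv => ?_⟩
  -- the tangent spaces of `ℝ⁶` are `ℝ⁶`; Mathlib deliberately provides no normed instances on
  -- `TangentSpace`, so we install the definitional ones locally (tree idiom, `TimeCones.lean`)
  letI : NormedAddCommGroup (TangentSpace (𝓡 6) (sliceMap c y)) :=
    inferInstanceAs (NormedAddCommGroup E6)
  letI : InnerProductSpace ℝ (TangentSpace (𝓡 6) (sliceMap c y)) :=
    inferInstanceAs (InnerProductSpace ℝ E6)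
  rw [inducedBilin_apply, euclideanMetric_apply]
  have hne : mfderiv (𝓡 4) (𝓡 6) (sliceMap c) y v ≠ 0 := fun h =>
    hv (mfderiv_sliceMap_injective c y (by rw [h, map_zero]))
  exact real_inner_self_pos.mpr hne

/-- **Slices are minimal**: the mean curvature of `sliceMap c` with respect to the normal `e₅` is `0`
(the slice is a level set of the LINEAR height function `z₅`, tree formula
`meanCurvature_unitGradient_eq_sum`: `H = ‖∇F‖⁻¹ ∑ Hess F(vᵢ, vᵢ) = 0`). [folklore] -/
theorem meanCurvature_sliceMap (c : ℝ)
    (hf : (euclideanMetric E6).IsSpacelikeImmersion (𝓡 4) (sliceMap c)) (y : S4) :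
    (euclideanMetric E6).meanCurvature (sliceMap c) contMDiff_pullbackBilin_holds hf
      (fun _ => axis) y = 0 := by
  haveI : Fact (Module.finrank ℝ E5 = 4 + 1) := ⟨finrank_euclideanSpace_fin⟩
  have hFl : ContDiff ℝ ∞ (heightL : E6 → ℝ) := heightL.contDiff
  have hy : (𝓡 4).IsInteriorPoint y := BoundarylessManifold.isInteriorPoint
  have hx : ∇ (heightL : E6 → ℝ) (sliceMap c y) ≠ 0 := by
    rw [gradient_heightL]
    simp [axis]
  have hdF : ∀ w : TangentSpace (𝓡 4) y,
      fderiv ℝ (heightL : E6 → ℝ) (sliceMap c y) (mfderiv (𝓡 4) 𝓘(ℝ, E6) (sliceMap c) y w) = 0 := by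
    intro w
    rw [ContinuousLinearMap.fderiv]
    exact heightL_mvfderiv_sliceMap c y w
  have hν : (fun z : S4 => (unitGradient (heightL : E6 → ℝ) (sliceMap c z) : E6)) = fun _ => axis := by
    funext z
    exact unitGradient_heightL _
  obtain ⟨b, -, -, hH⟩ := meanCurvature_unitGradient_eq_sum (W := E6) (I' := 𝓡 4) hFl
    contMDiff_pullbackBilin_holds hf hy hx hdF (finrank_euclideanSpace_fin (𝕜 := ℝ) (n := 4))
  rw [hν] at hH
  rw [hH]
  have hfd : fderiv ℝ (heightL : E6 → ℝ) = fun _ => heightL := by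
    funext z
    exact ContinuousLinearMap.fderiv heightL
  have h2 : ∀ a a' : E6, iteratedFDeriv ℝ 2 (heightL : E6 → ℝ) (sliceMap c y) ![a, a'] = 0 := by
    intro a a'
    rw [iteratedFDeriv_two_apply, hfd, fderiv_fun_const]
    rfl
  simp [h2]

/-- **The interface `IsCylinderMCF` is inhabited**: the static slice at height `c` with the upward
normal `e₅` is a smooth mean curvature flow of embedded cross-sections on every `[T, ∞)`
(`∂F/∂t = 0 = -H e₅` since slices are minimal). [folklore] -/
theorem isCylinderMCF_staticSlice (c T : ℝ) :
    IsCylinderMCF S4 (fun _ => sliceMap c) (fun _ _ => axis) T where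
  contMDiffOn := ⟨Set.univ, isOpen_univ, Set.subset_univ _,
    ((contMDiff_sliceMap c).comp contMDiff_snd).contMDiffOn⟩
  isSmoothEmbedding _ _ := isSmoothEmbedding_sliceMap c
  mem_cyl _ _ x := sum_sq_sliceMap c x
  isSpacelikeImmersion _ _ := isSpacelikeImmersion_sliceMap c
  isUnitNormal _ _ := by
    refine ⟨fun y v => ?_, fun y => ?_⟩
    · rw [euclideanMetric_apply]
      exact heightL_mvfderiv_sliceMap c y v
    · rw [euclideanMetric_apply]
      change ⟪axis, axis⟫ = (1 : ℝ)
      simp [axis]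
  normal_tangent _ _ x := by simp [axis, castSucc_ne_five]
  contMDiff_normal _ _ := contMDiff_const
  velocity_eq t _ x := by
    rw [meanCurvature_sliceMap, neg_zero, zero_smul]
    show mfderiv 𝓘(ℝ, ℝ) (𝓡 6) (fun _ : ℝ => sliceMap c x) t 1 = 0
    rw [mfderiv_const]
    rfl

end StaticSlice

/-! ## Statements of the stubs -/

/-- Statement of `stub_finiteTimeHalf` — **THE FINITE-TIME HALF** (the open step shared by every line
of this crux; size XL, research-level). For a homotopy 4-sphere `M` and a smooth embedding `ι` into `N`
separating the ends with `λ_cyl(range ι) < 4/e`, there is an IMMORTAL SMOOTH mean curvature flow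
`(F t)_{t ≥ T}` of cross-section embeddings OF `M` ITSELF in `N`, separating the ends, with
`λ_cyl(range (F t)) < 4/e`, confined to the slab of `ι` up to one unit of height. Intended construction:
CMS generic perturbation of `ι` (λ continuous under small `C^∞` graphs, so still `< 4/e`) + mean
curvature flow with Daniels-Holgate surgery in `N`: Hamilton monotonicity ⇒ blow-ups are Euclidean
shrinkers of entropy `< 4/e`; CMS density drop §§3–5 ported to `N` ⇒ generically only multiplicity-one
`S⁴` points and `S³ × ℝ` necks (strictly below `4/e` the bubble sheet never enters, CMS II §1.2; CHHW
Thm 1.17 holds in arbitrary ambients); every neck on a homotopy-sphere component separates it into two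
homotopy balls, so split-off components are homotopy spheres of area `< 0.4715 vol S⁴`, which cannot
reach a slice and die at round points (hence are `S⁴`), while the ROOT (end-separating, area `≥ vol S⁴`,
White 1995 Thm 1(i)) never dies; each surgery at fixed scale costs a quantum of area, so there are
finitely many, and after the last one the root flows smoothly forever and is diffeomorphic to
`M # (spheres) ≅ M`. True for `M = S⁴` and the slice (static flow); false for a thin exotic cross-section
(this is where SPC4-hardness lives, cdisprove sandwich).
[cite: ChodoshMantoulidisSchulze2025, Cor. 1.5 (b), Cor. 1.22 (b), §§3–5]
[cite: DanielsHolgate2022, Thm. 1.1] [cite: ChoiHaslhoferHershkovitsWhite2022, Thm. 1.17, Cor. 1.18] -/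
def FiniteTimeHalf : Prop :=
  ∀ (M : Type) [TopologicalSpace M] [T2Space M] [SecondCountableTopology M]
    [ChartedSpace E4 M] [IsManifold (𝓡 4) ∞ M],
    M ≃ₕ Metric.sphere (0 : E5) 1 →
    ∀ ι : M → E6, Manifold.IsSmoothEmbedding (𝓡 4) (𝓡 6) ∞ ι →
    (∀ x, ∑ i : Fin 5, ι x (Fin.castSucc i) ^ 2 = 1) → SeparatesEnds (Set.range ι) →
    cylEntropy (Set.range ι) < ENNReal.ofReal (4 / Real.exp 1) →
    ∃ (F : ℝ → M → E6) (ν : ℝ → M → E6) (T : ℝ), IsCylinderMCF M F ν T ∧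
      (∀ t, T ≤ t → SeparatesEnds (Set.range (F t))) ∧
      (∀ t, T ≤ t → cylEntropy (Set.range (F t)) < ENNReal.ofReal (4 / Real.exp 1)) ∧
      (∀ t, T ≤ t → ∀ x, ∃ y y' : M, ι y 5 - 1 ≤ F t x 5 ∧ F t x 5 ≤ ι y' 5 + 1)

/-- Statement of `stub_fluxIdentity` — **THE FLUX IDENTITY** (the card's first lemma, REPAIRED per
triage r1-1/2/3: `ConnectedSpace M`, and the defining function replaced by the unit normal field itself;
size L). For a compact CONNECTED `4`-manifold `M`, a smooth embedding `ι : M → N` separating the ends,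
and any continuous unit normal field `ν` along `ι` tangent to `N`, the flux of the vertical Killing field
`e₅ = ∂_s` through `M` is `± vol(S⁴)`:
`|∫_M ν₅ d(ι^* μH⁴)| = μH⁴(S⁴ ⊂ ℝ⁵)` (`ι^* μH⁴ = Measure.comap ι μH[4]`, the induced area measure).
Proof route: `N ∖ ι(M)` has exactly two components `U₋ ∋` lower end, `U₊ ∋` upper end (connected closed
two-sided hypersurface of `N ≅ S⁵ ∖ {2 points}` + separation), `ν` points into `U₊` everywhere or into
`U₋` everywhere (continuity on connected `M`), and the divergence theorem for the parallel field `e₅`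
(`div_N e₅ = 0`) on `U₋ ∩ {z₅ ≥ -R'}` gives `∫_M ⟪e₅, ν_out⟫ = ∫_{S⁴ × {-R'}} 1 = vol(S⁴)`;
equivalently Stokes for the closed 4-form `Ω = ι_{e₅} dvol_N = pr₁^* dvol_{S⁴}`. FALSE without
connectedness (two slices with parallel normals: flux `2 vol` or `0`; `Triage.fluxIdentity_false`).
Corollaries (not stubs): `area(M) - vol(S⁴) = ∫_M (1 - u) ≥ 0` with equality iff `M` is a slice
(`OnlySlicesAtTheFloor`), and the deficit is a Lyapunov function along the flow with
`∫∫ H² ≤ D(T)`. [folklore] -/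
def FluxIdentity : Prop :=
  ∀ (M : Type) [TopologicalSpace M] [T2Space M] [SecondCountableTopology M]
    [ChartedSpace E4 M] [IsManifold (𝓡 4) ∞ M] [CompactSpace M] [ConnectedSpace M]
    [MeasurableSpace M] [BorelSpace M]
    (ι : M → E6), Manifold.IsSmoothEmbedding (𝓡 4) (𝓡 6) ∞ ι →
    (∀ x, ∑ i : Fin 5, ι x (Fin.castSucc i) ^ 2 = 1) → SeparatesEnds (Set.range ι) →
    ∀ ν : M → E6, Continuous ν → (euclideanMetric E6).IsUnitNormal (𝓡 4) ι ν 1 →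
      (∀ x, ∑ i : Fin 5, ν x (Fin.castSucc i) * ι x (Fin.castSucc i) = 0) →
      |∫ x, ν x 5 ∂(Measure.comap ι (μH[4] : Measure E6))| =
        (μH[4] (Metric.sphere (0 : E5) 1)).toReal

/-- Statement of `stub_relaxation` — **RELAXATION OF THE IMMORTAL CROSS-SECTION TO THE GROUND STATE**
(the `t → ∞` half of the crux; killing-flux T3 merged with `ground-state-relaxation`, as all three
triagers recommend; size L). An immortal smooth mean curvature flow in `N` of compact connected
cross-sections separating the ends, with `λ_cyl < 2` along the flow, has `λ_cyl(F s) → 1`: for every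
`ε > 0`, `λ_cyl(range (F s)) < 1 + ε` for all `s ≥ t₀`. Proof route: area is non-increasing with floor
`vol(S⁴)` (tree `hausdorffMeasure_sphere_le_of_separatesEnds`) ⇒ `∫_T^∞ ∫ H² ≤ area(T) - vol < ∞`;
`M_t` stays in a slab (avoidance with the static slices); time-translates converge (Brakke/Ilmanen
compactness in `N`, Allard) to a STATIC stationary integral varifold `V` of mass `A_∞ ∈ [vol, 2 vol)`
(no mass loss: Brakke's inequality with `∫∫H² → 0` on unit windows); `V` is horizontal — first variation
along `X = φ(s) ∂_s`, `Hess_N s = 0`, gives `∫ φ'(s) |∂_s^⊤|² dV = 0` for all `φ` — hence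
`V = ∑ mᵢ [S⁴ × {sᵢ}]` (equivalently: `V` contains the top and bottom slices of its support by the
strong maximum principle against the totally geodesic slice foliation), and `A_∞ < 2 vol` forces ONE
slice with multiplicity ONE; backward Hamilton monotonicity `F̂_{p,τ}(M_s) ≤ F̂_{p,τ+1}(M_{s-1})`
(Harnack matrix of the product kernel `≥ 0`, numerically coercive: triage r1-2/3) moves every scale to
`τ ≥ 1`, where `F̂` is an equicontinuous family on the slab with tails controlled by the tree's
`one_sub_tail_le_zonal`, so `limsup_s λ_cyl(M_s) ≤ λ_cyl(slice) = 1` by contradiction along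
subsequences. LEANS ON the route's support item `SliceCalibration` (stmt-SmoothPoincare4-7634,
`λ_cyl(slice) ≤ 1`; its `≥ 1` half is the tree's `one_le_cylEntropy_slice`): if 7634 is refuted the
thresholds here and in `EpsilonGraphical` restate 1:1 with the corrected normalisation, like every
route item. [cite: Allard1972, §6 (compactness of integral varifolds)]
[cite: White2005, Thm. 1.1 (local regularity, Riemannian ambient)] [cite: BorisenkoMiquel2012, Thm. 1] -/
def Relaxation : Prop :=
  ∀ (M : Type) [TopologicalSpace M] [T2Space M] [SecondCountableTopology M]
    [ChartedSpace E4 M] [IsManifold (𝓡 4) ∞ M] [CompactSpace M] [ConnectedSpace M]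
    (F : ℝ → M → E6) (ν : ℝ → M → E6) (T : ℝ), IsCylinderMCF M F ν T →
    (∀ t, T ≤ t → SeparatesEnds (Set.range (F t))) →
    (∀ t, T ≤ t → cylEntropy (Set.range (F t)) < 2) →
    ∀ ε : ℝ, 0 < ε → ∃ t₀ : ℝ, T ≤ t₀ ∧
      ∀ s, t₀ ≤ s → cylEntropy (Set.range (F s)) < ENNReal.ofReal (1 + ε)

/-- Statement half of `stub_epsilonGraphical` — **ε-REGULARITY TO A GRAPH** (size L). There is a
UNIVERSAL `ε > 0` such that: if a smooth mean curvature flow in `N` of compact connected cross-sections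
has, during one unit of time `[t-1, t]`, separating time-slices with `λ_cyl < 1 + ε`, then `F t` is
GRAPHICAL (`IsGraphical`: the shadow in `S⁴` is an injective immersion). The registered stub is
`FluxIdentity → EpsilonGraphical`; proof route: (1) curvature — at scales `τ ≤ r₀² ≪ inj(N)² = π²` the
typed kernel `vol(S⁴) H_{S⁴} G_ℝ` is the `4`-dimensional Gaussian density of the 5-manifold `N` up to
`1 + o(1)` (Minakshisundaram–Pleijel; intrinsic vs chordal distance in `N ⊂ ℝ⁶`), so `λ_cyl < 1 + ε`
on `[t-1, t]` feeds White's local regularity theorem (mean curvature flow in a Riemannian manifold /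
with bounded forcing after `N ⊂ ℝ⁶`) and gives `|A| ≤ C` on `M_t`, `C` universal; (2) tilt — by the
area bound `μH⁴(M_t) ≤ (1+ε) μH⁴(S⁴)` (tree `measure_ratio_le_cylEntropy`) and the FLUX IDENTITY with
`ν` oriented so that the flux is `+vol(S⁴)`, `∫_{M_t} (1 - u) dμ = area - vol ≤ ε vol(S⁴)` with
`1 - u ≥ 0`, and `|∇u| ≤ |A| ≤ C` turns this `L¹` budget into `u > 1/2` pointwise once
`ε vol(S⁴) < (1/4) · inf_x μ(B^{M_t}_{1/4C}(x))` — so `e₅ ∉ TΣ_t` and the shadow is an immersion;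
(3) one sheet — `u` is the Jacobian of the shadow `M_t → S⁴`, a local diffeomorphism of the compact `M`
with constant sheet number `k`, and `∫ u = k vol(S⁴)` (area formula) equals the flux `vol(S⁴)`, so
`k = 1` and the shadow is injective. A STATIC version (no flow) is false for every `ε` (a steep wrinkle
of tiny area), which is why one unit of flow is part of the hypothesis.
[cite: White2005, Thm. 1.1 and §§3–4] [cite: Allard1972, §8 (regularity)] -/
def EpsilonGraphical : Prop :=
  ∃ ε : ℝ, 0 < ε ∧
    ∀ (M : Type) [TopologicalSpace M] [T2Space M] [SecondCountableTopology M]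
      [ChartedSpace E4 M] [IsManifold (𝓡 4) ∞ M] [CompactSpace M] [ConnectedSpace M]
      (F : ℝ → M → E6) (ν : ℝ → M → E6) (T : ℝ), IsCylinderMCF M F ν T →
      ∀ t : ℝ, T + 1 ≤ t →
        (∀ s ∈ Set.Icc (t - 1) t, SeparatesEnds (Set.range (F s))) →
        (∀ s ∈ Set.Icc (t - 1) t, cylEntropy (Set.range (F s)) < ENNReal.ofReal (1 + ε)) →
        IsGraphical M (F t)

/-- Statement of `stub_graphicalIsSphere` — **A GRAPHICAL CROSS-SECTION IS A STANDARD SPHERE**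
(differential topology; size M, provable now). If `M` is compact and connected and `ι : M → N` is a
smooth embedding whose shadow `truncL ∘ ι : M → ℝ⁵` is an injective immersion, then `M ≃ₘ S⁴`:
the shadow lands in `S⁴` (`∑_{i<5} (ι x)ᵢ² = 1`), co-restricts to a smooth injective map `M → S⁴`
with injective — hence bijective — differential (Mathlib `ContMDiff.codRestrict_sphere`,
`mfderiv_coe_sphere_injective`), which is a local diffeomorphism (inverse function theorem, tree
`Literature/Geometry/Manifold/InverseFunctionTheorem`, `OpenEmbeddingCriterion`), so its image is open
and compact in the connected `S⁴`: a bijective local diffeomorphism, i.e. a diffeomorphism.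
[cite: HirschDT1976, Ch. 1 §3 Thm. 3.1; Ch. 2 §1] -/
def GraphicalIsSphere : Prop :=
  ∀ (M : Type) [TopologicalSpace M] [T2Space M] [SecondCountableTopology M]
    [ChartedSpace E4 M] [IsManifold (𝓡 4) ∞ M] [CompactSpace M] [ConnectedSpace M]
    (ι : M → E6), Manifold.IsSmoothEmbedding (𝓡 4) (𝓡 6) ∞ ι →
    (∀ x, ∑ i : Fin 5, ι x (Fin.castSucc i) ^ 2 = 1) → IsGraphical M ι →
    Nonempty (M ≃ₘ⟮𝓡 4, 𝓡 4⟯ Metric.sphere (0 : E5) 1)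

/-! ## Registered stubs -/

/-- STUB 1 · THE FINITE-TIME HALF — the Chodosh–Mantoulidis–Schulze / Daniels-Holgate port to `N`
producing an immortal smooth flow of the root component `≅ M` (see `FiniteTimeHalf`).
[size XL; research-level; HARDEST; shared with every line of the crux — the lines
`proxy-models-below-bubble-sheet` / `separating-sheet-genealogy` / `tilted-mean-convexity` decompose
exactly this stub] [cite: ChodoshMantoulidisSchulze2025, Cor. 1.5 (b)] -/
theorem stub_finiteTimeHalf : FiniteTimeHalf := by
  sorry

/-- STUB 2 · THE FLUX IDENTITY, repaired (connected `M`, unit normal field): the line's lever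
(see `FluxIdentity`). [size L: Jordan–Brouwer in `N` + divergence theorem on a smooth region of
`N ⊂ ℝ⁶` + `μH⁴⌊ι(M) = ι_#(vol)`] [folklore] -/
theorem stub_fluxIdentity :
    ∀ (M : Type) [TopologicalSpace M] [T2Space M] [SecondCountableTopology M]
      [ChartedSpace (EuclideanSpace ℝ (Fin 4)) M] [IsManifold (𝓡 4) ∞ M] [CompactSpace M]
      [ConnectedSpace M] [MeasurableSpace M] [BorelSpace M]
      (ι : M → EuclideanSpace ℝ (Fin 6)), Manifold.IsSmoothEmbedding (𝓡 4) (𝓡 6) ∞ ι →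
      (∀ x, ∑ i : Fin 5, ι x (Fin.castSucc i) ^ 2 = 1) →
      (∃ R : ℝ, ∀ a b : EuclideanSpace ℝ (Fin 6), ∑ i : Fin 5, a (Fin.castSucc i) ^ 2 = 1 →
        ∑ i : Fin 5, b (Fin.castSucc i) ^ 2 = 1 → a 5 ≤ -R → R ≤ b 5 →
        ¬ JoinedIn ({z : EuclideanSpace ℝ (Fin 6) | ∑ i : Fin 5, z (Fin.castSucc i) ^ 2 = 1} \
          Set.range ι) a b) →
      ∀ ν : M → EuclideanSpace ℝ (Fin 6), Continuous ν →
        (euclideanMetric (EuclideanSpace ℝ (Fin 6))).IsUnitNormal (𝓡 4) ι ν 1 →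
        (∀ x, ∑ i : Fin 5, ν x (Fin.castSucc i) * ι x (Fin.castSucc i) = 0) →
        |∫ x, ν x 5 ∂(Measure.comap ι (μH[4] : Measure (EuclideanSpace ℝ (Fin 6))))| =
          (μH[4] (Metric.sphere (0 : EuclideanSpace ℝ (Fin 5)) 1)).toReal := by
  sorry

/-- STUB 3 · RELAXATION `λ_cyl(F s) → 1` for immortal flows of connected separating cross-sections with
`λ_cyl < 2` (see `Relaxation`). [size L; the line's own hardest analytic stub together with STUB 4;
leans on SliceCalibration (stmt-7634), Hamilton monotonicity in `N`, Brakke–Ilmanen–Allard compactness]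
[cite: Allard1972, §6] -/
theorem stub_relaxation : Relaxation := by
  sorry

/-- STUB 4 · ε-REGULARITY TO A GRAPH, FROM THE FLUX IDENTITY: White's local regularity gives the
curvature bound, the flux identity gives the tilt budget `∫(1-u) ≤ ε vol` and the sheet count `1`
(see `EpsilonGraphical`). [size L] [cite: White2005, Thm. 1.1] -/
theorem stub_epsilonGraphical : FluxIdentity → EpsilonGraphical := by
  sorry

/-- STUB 5 · a compact connected cross-section whose shadow is an injective immersion is `≃ₘ S⁴`
(see `GraphicalIsSphere`). [size M; provable now] [cite: HirschDT1976, Ch. 1 §3 Thm. 3.1] -/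
theorem stub_graphicalIsSphere :
    ∀ (M : Type) [TopologicalSpace M] [T2Space M] [SecondCountableTopology M]
      [ChartedSpace (EuclideanSpace ℝ (Fin 4)) M] [IsManifold (𝓡 4) ∞ M] [CompactSpace M]
      [ConnectedSpace M] (ι : M → EuclideanSpace ℝ (Fin 6)),
      Manifold.IsSmoothEmbedding (𝓡 4) (𝓡 6) ∞ ι →
      (∀ x, ∑ i : Fin 5, ι x (Fin.castSucc i) ^ 2 = 1) →
      (Function.Injective ((truncL : EuclideanSpace ℝ (Fin 6) → EuclideanSpace ℝ (Fin 5)) ∘ ι) ∧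
        ∀ x : M, Function.Injective
          (mfderiv (𝓡 4) (𝓡 5) ((truncL : EuclideanSpace ℝ (Fin 6) → EuclideanSpace ℝ (Fin 5)) ∘ ι) x)) →
      Nonempty (M ≃ₘ⟮𝓡 4, 𝓡 4⟯ Metric.sphere (0 : EuclideanSpace ℝ (Fin 5)) 1) := by
  sorry

/-! ## Composition (sorry-free) -/

/-- `4/e ≤ 2` in `ℝ≥0∞` (`2 ≤ e`): the entropy bound handed over by STUB 1 is below the single-sheet
threshold of STUB 3. [folklore] -/
theorem ofReal_four_div_exp_le_two : ENNReal.ofReal (4 / Real.exp 1) ≤ 2 := by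
  have h : 4 / Real.exp 1 ≤ 2 := by
    rw [div_le_iff₀ (Real.exp_pos 1)]
    linarith [Real.add_one_le_exp (1 : ℝ)]
  calc ENNReal.ofReal (4 / Real.exp 1) ≤ ENNReal.ofReal 2 := ENNReal.ofReal_le_ofReal h
    _ = 2 := by simp

/-- **Main composition (kernel-checked; no sorry in this proof).** The crux — written readably with
the tree's `cylEntropy` and this file's `SeparatesEnds`, which is the route decl `CylinderRungTwo` up to
unfolding definitions (see `CylinderRungTwo_of`) — from the five stub statements: STUB 1 gives an
immortal smooth flow of cross-section embeddings of `M` with `λ_cyl < 4/e ≤ 2`; STUB 3 relaxes it below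
the universal `1 + ε` of STUB 4 (obtained from STUB 2) from some `t₀` on; STUB 4 at time `t₀ + 1` makes
`F (t₀+1)` graphical; STUB 5 concludes. Instances `CompactSpace M`, `ConnectedSpace M` from `M ≃ₕ S⁴`
are PROVED tree theorems. -/
theorem cylinderRungTwo_of_parts (h₁ : FiniteTimeHalf) (h₂ : FluxIdentity) (h₃ : Relaxation)
    (h₄ : FluxIdentity → EpsilonGraphical) (h₅ : GraphicalIsSphere) :
    ∀ (M : Type) [TopologicalSpace M] [T2Space M] [SecondCountableTopology M]
      [ChartedSpace E4 M] [IsManifold (𝓡 4) ∞ M],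
      M ≃ₕ Metric.sphere (0 : E5) 1 → ∀ ι : M → E6, Manifold.IsSmoothEmbedding (𝓡 4) (𝓡 6) ∞ ι →
      (∀ x, ∑ i : Fin 5, ι x (Fin.castSucc i) ^ 2 = 1) → SeparatesEnds (Set.range ι) →
      cylEntropy (Set.range ι) < ENNReal.ofReal (4 / Real.exp 1) →
      Nonempty (M ≃ₘ⟮𝓡 4, 𝓡 4⟯ Metric.sphere (0 : E5) 1) := by
  intro M _ _ _ _ _ e ι hι hN hsep hent
  -- instances from `M ≃ₕ S⁴` (PROVED in the tree)
  haveI : CompactSpace M :=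
    Literature.Topology.FourManifolds.compactSpace_of_homotopyEquiv_sphere_four_holds M e
  haveI : PathConnectedSpace M := by
    haveI := Literature.Topology.FourManifolds.pathConnectedSpace_sphere_four
    exact Literature.Topology.FourManifolds.pathConnectedSpace_of_homotopyEquiv e
  -- STUB 4 (from STUB 2): the universal ε of the graphical regime
  obtain ⟨ε, hε, hgraph⟩ := h₄ h₂
  -- STUB 1: the finite-time half — an immortal smooth flow of cross-section embeddings of `M`
  obtain ⟨F, ν, T, hflow, hsepF, hentF, -⟩ := h₁ M e ι hι hN hsep hent
  have h2 : ∀ t, T ≤ t → cylEntropy (Set.range (F t)) < 2 := fun t ht =>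
    lt_of_lt_of_le (hentF t ht) ofReal_four_div_exp_le_two
  -- STUB 3: relaxation below `1 + ε` from some time `t₀ ≥ T` on
  obtain ⟨t₀, hTt₀, hsmall⟩ := h₃ M F ν T hflow hsepF h2 ε hε
  -- STUB 4 at time `t₀ + 1`: after one unit of flow in the `(1+ε)`-regime the cross-section is graphical
  have hg : IsGraphical M (F (t₀ + 1)) :=
    hgraph M F ν T hflow (t₀ + 1) (by linarith)
      (fun s hs => hsepF s (by linarith [hs.1]))
      (fun s hs => hsmall s (by linarith [hs.1]))
  -- STUB 5: a graphical cross-section is a standard sphere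
  exact h₅ M (F (t₀ + 1)) (hflow.isSmoothEmbedding _ (by linarith)) (hflow.mem_cyl _ (by linarith)) hg

/-- **The skeleton concludes the crux BY NAME.** `CylinderEntropy.CylinderRungTwo`
(stmt-SmoothPoincare4-7631) from the registered stubs 1–5 (the route decl unfolds to the readable
statement of `cylinderRungTwo_of_parts`: `cylEntropy`, `SeparatesEnds`, `cylN` are the typed
expressions verbatim). -/
theorem CylinderRungTwo_of : CylinderRungTwo :=
  cylinderRungTwo_of_parts stub_finiteTimeHalf stub_fluxIdentity stub_relaxation
    stub_epsilonGraphical stub_graphicalIsSphere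

end Summit.SmoothPoincare4.SmoothPoincare4.Cruxes.CylinderRungTwo.KillingFlux

end
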